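import Summits.BirchSwinnertonDyer.BirchSwinnertonDyer.Theorems.SignedBaseChangeAnticyclotomicEisensteinDivisibilityAdmdefUnrLineNonzero
import Literature.NumberTheory.EllipticCurves.ZpExtensionUnramifiedProofs
import HarnessLib

/-!
# Line `admdef` (crux `AnticyclotomicEisensteinDivisibility`, stmt-BirchSwinnertonDyer-20727), rigidity road (M4), preliminaries:
# arithmetic of square-free admissible products and SELMER BOOKKEEPING at the bottom layer in CHKLL25's currency

LEAD seat bsd-line-sbc-p1 (gen 28), `--supports stmt-BirchSwinnertonDyer-20727` (helper; OFF the v23 composition path).  The bookkeeping used by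
Howard's merge induction (`…AdmdefHowardMerge`, same seat) and by the vanishing lemma, for a signed bipartite system `B` (CHKLL25 Thm. 7.4 as
typed, `IsSignedBipartiteSystem`) and the `m`-ordinary signed Selmer groups `Sel^ε_m(K_n, E[p^j]) = signedOrdSelmerTorsion (E/K) p κ ε m n j`
(signed at `p`, ORDINARY at the primes of `m`, UNRAMIFIED at every other finite prime):

* §1 square-free products: `div_arith` (`(n/q)·q = n`, `q ∤ n/q`, one prime factor less), `div_mem_admissibleProducts`,
  `div_mem_indefProducts_of_mem_defProducts` / `div_mem_defProducts_of_mem_indefProducts` (parity), `eq_of_card_primeFactors_eq_one`;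
* §2 Selmer bookkeeping: TRANSFER DOWN / UP along `n ∣ n'` (`mem_signedOrdSelmerTorsion_of_dvd_of_forall_unramifiedAt` /
  `…_of_forall_ordinaryAt`: the groups `Sel_n ⊆? Sel_{n'}` differ only by «unramified» vs «ordinary» at the primes of `n'/n`, [Howard2006] §3.1,
  Prop. 2.2.9), `kappa_layer_mem_signedOrdSelmerTorsion` (`κ_j(m)_n ∈ Sel^ε_m(K_n, E[p^j])`), `resOfLe_inertia_ne_zero_of_not_mem_unramifiedAt`
  (a class NOT unramified at `𝔓 ∣ v ∤ p` has non-zero ordinary coordinate `res_{I_𝔓 ∩ Gal(K̄/K_∞)}`, since `I_𝔓 ≤ ker κ`, Washington 13.2 = tree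
  `ZpExtension.inertia_le_kerSubgroup_holds`), `decompositionSubgroup_le_kerSubgroup_of_isAdmissiblePrime` (`D_𝔓 ≤ ker κ` for EVERY prime `𝔓` over
  an admissible `q`: the chosen prime by `ZpExtension.decomp_le_kerSubgroup_of_span_natCast`, the others by conjugation), Bézout
  `eq_zero_of_zsmul_eq_zero_of_not_dvd`.  (Depth: `B.HasUnitLambda N` is a level-one statement by the landed
  `…AdmdefBipartiteNVLevelOne.hasUnitLambda_iff_level_one`, LEAD g16.)

HONEST FRAMING: theorems only (no definition, no named fact, no `sorry`); nothing about the crux, the anchors (K1) or BSD is asserted.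

References: [cite: Howard2006, §3.1, Prop. 2.2.9, Def. 3.2.1] [cite: CastellaEtAl2025, §7.2, Thm. 7.4 (arXiv:2308.10474v2 p. 30)]
[cite: Washington1997, Prop. 13.2] [cite: NeukirchANT1999, Ch. I §9 (9.1)].
-/

-- D-0017: single-problem summit, the namespace repeats the problem name by design.
set_option linter.dupNamespace false
set_option autoImplicit false

noncomputable section

open scoped Classical NumberField Pointwise

namespace Summit.BirchSwinnertonDyer.BirchSwinnertonDyer.Theorems.SignedBaseChangeAcDivAdmdefSelmerBookkeeping

open WeierstrassCurve NumberField IsDedekindDomain Field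
open Literature.NumberTheory.EllipticCurves Literature.NumberTheory.GaloisRepresentations
open Literature.NumberTheory.EllipticCurves.CastellaHsuKunduLeeLiu2025
open Literature.NumberTheory.EllipticCurves.BertoliniDarmon2005
open Summit.BirchSwinnertonDyer.BirchSwinnertonDyer.Theorems.SignedBaseChangeAcDivAdmdefBipartitePropagation
open Summit.BirchSwinnertonDyer.BirchSwinnertonDyer.Theorems.SignedBaseChangeAcDivAdmdefUnitLambdaOfLoc
open Summit.BirchSwinnertonDyer.BirchSwinnertonDyer.Theorems.SignedBaseChangeAcDivAdmdefRootVisibleOfUnitLambda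
open Summit.BirchSwinnertonDyer.BirchSwinnertonDyer.Theorems.SignedBaseChangeAcDivAdmdefUnrLineNonzero

universe u

/-! ## §1 Arithmetic of square-free products of admissible primes -/

section Arith

variable {N : ℕ} {K : Type} [Field K] {a : ℕ → ℤ} {p : ℕ}

/-- **Removing a prime from a square-free product**: for `n` square-free and a prime `q ∣ n`, `(n/q)·q = n`, `q ∤ n/q`, `n/q` is square-free,
every divisor of `n/q` divides `n`, and `n/q` has one prime factor less. [folklore] -/
theorem div_arith {n q : ℕ} (hn : Squarefree n) (hq : q.Prime) (hqn : q ∣ n) :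
    n / q * q = n ∧ ¬ q ∣ n / q ∧ Squarefree (n / q) ∧ (n / q).primeFactors.card + 1 = n.primeFactors.card := by
  have h1 : n / q * q = n := Nat.div_mul_cancel hqn
  have hsq : Squarefree (n / q * q) := by rw [h1]; exact hn
  rw [Nat.squarefree_mul_iff] at hsq
  obtain ⟨hcop, hsq', -⟩ := hsq
  refine ⟨h1, fun h ↦ hq.ne_one ((Nat.coprime_comm.mp hcop).eq_one_of_dvd h), hsq', ?_⟩
  have hunion := Nat.Coprime.primeFactors_mul hcop
  rw [h1, hq.primeFactors] at hunion
  have hdisj : Disjoint (n / q).primeFactors {q} := by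
    rw [← hq.primeFactors]; exact Nat.Coprime.disjoint_primeFactors hcop
  rw [hunion, Finset.card_union_of_disjoint hdisj, Finset.card_singleton]

/-- `n/q ∈ 𝒩_j` for `n ∈ 𝒩_j` and a prime `q ∣ n` (divisors of `n/q` divide `n`). [cite: CastellaEtAl2025, §7.2 (arXiv:2308.10474v2 p0030 L1–L6)] -/
theorem div_mem_admissibleProducts {j n q : ℕ} (hn : n ∈ admissibleProducts N K a p j) (hq : q.Prime) (hqn : q ∣ n) :
    n / q ∈ admissibleProducts N K a p j :=
  ⟨(div_arith hn.1 hq hqn).2.2.1, fun ℓ hℓ hℓn ↦ hn.2 ℓ hℓ (hℓn.trans (Nat.div_dvd_of_dvd hqn))⟩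

/-- `n/q ∈ 𝒩_j^ind` for `n ∈ 𝒩_j^def` and a prime `q ∣ n` (parity drops by one). [cite: Howard2006, Def. 3.2.1] -/
theorem div_mem_indefProducts_of_mem_defProducts {j n q : ℕ} (hn : n ∈ defProducts N K a p j) (hq : q.Prime) (hqn : q ∣ n) :
    n / q ∈ indefProducts N K a p j := by
  refine ⟨div_mem_admissibleProducts hn.1 hq hqn, ?_⟩
  have hcard := (div_arith hn.1.1 hq hqn).2.2.2
  have hodd := hn.2
  rw [← hcard, Nat.odd_add_one] at hodd
  exact Nat.not_odd_iff_even.mp hodd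

/-- `n/q ∈ 𝒩_j^def` for `n ∈ 𝒩_j^ind` and a prime `q ∣ n`. [cite: Howard2006, Def. 3.2.1] -/
theorem div_mem_defProducts_of_mem_indefProducts {j n q : ℕ} (hn : n ∈ indefProducts N K a p j) (hq : q.Prime) (hqn : q ∣ n) :
    n / q ∈ defProducts N K a p j := by
  refine ⟨div_mem_admissibleProducts hn.1 hq hqn, ?_⟩
  have hcard := (div_arith hn.1.1 hq hqn).2.2.2
  have heven := hn.2
  rw [← hcard, Nat.even_add_one] at heven
  exact Nat.not_even_iff_odd.mp heven

/-- A square-free `n` with exactly one prime factor IS that prime. [folklore] -/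
theorem eq_of_card_primeFactors_eq_one {n q : ℕ} (hn : Squarefree n) (hcard : n.primeFactors.card = 1) (hq : q.Prime) (hqn : q ∣ n) :
    n = q := by
  obtain ⟨ℓ, hℓ⟩ := Finset.card_eq_one.mp hcard
  have hqmem : q ∈ n.primeFactors := Nat.mem_primeFactors.mpr ⟨hq, hqn, hn.ne_zero⟩
  rw [hℓ, Finset.mem_singleton] at hqmem
  subst hqmem
  rw [← Nat.prod_primeFactors_of_squarefree hn, hℓ, Finset.prod_singleton]

end Arith

/-! ## §2 Selmer bookkeeping at the bottom layer in CHKLL25's currency -/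

section Selmer

variable {K : Type} [Field K] [NumberField K] {W : WeierstrassCurve ℚ} [W.IsElliptic] [W.IsGloballyMinimal] {p : ℕ} [Fact p.Prime]
  {κ : ZpExtension K p} {γ : absoluteGaloisGroup K} {N : ℕ} {ε : ℤˣ} {B : SignedBipartiteSystem W K p κ}

omit [W.IsElliptic] [W.IsGloballyMinimal] in
/-- **Transfer DOWN along `n ∣ n'`**: a class of `Sel^ε_{n'}(K_m, E[p^j])` which is UNRAMIFIED at every prime of `n'` not dividing `n` lies in
`Sel^ε_n(K_m, E[p^j])` (the two groups differ only by «ordinary» vs «unramified» at those primes). [cite: CastellaEtAl2025, §7.2 (arXiv:2308.10474v2 p0030 L16–L27)]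
[cite: Howard2006, §3.1, Prop. 2.2.9] -/
theorem mem_signedOrdSelmerTorsion_of_dvd_of_forall_unramifiedAt {n n' m j : ℕ} (hdvd : n ∣ n')
    {c : (W.baseChange K).torsionH1Over ((p : ℤ) ^ j) (κ.layerSubgroup m)}
    (hc : c ∈ signedOrdSelmerTorsion (W.baseChange K) p κ ε n' m j)
    (hunr : ∀ ℓ : ℕ, ℓ.Prime → ℓ ∣ n' → ¬ ℓ ∣ n → ∀ v : HeightOneSpectrum (𝓞 K), ((p : ℕ) : 𝓞 K) ∉ v.asIdeal →
      ((ℓ : ℕ) : 𝓞 K) ∈ v.asIdeal → ∀ 𝔓 ∈ v.primesAbove, c ∈ unramifiedAt (W.baseChange K) ((p : ℤ) ^ j) (κ.layerSubgroup m) 𝔓) :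
    c ∈ signedOrdSelmerTorsion (W.baseChange K) p κ ε n m j := by
  rw [mem_signedOrdSelmerTorsion_iff] at hc ⊢
  obtain ⟨hA, hB, hC⟩ := hc
  refine ⟨hA, fun v hpv hex 𝔓 h𝔓 ↦ ?_, fun v hpv hno 𝔓 h𝔓 ↦ ?_⟩
  · obtain ⟨ℓ, hℓ, hℓn, hℓv⟩ := hex
    exact hB v hpv ⟨ℓ, hℓ, hℓn.trans hdvd, hℓv⟩ 𝔓 h𝔓
  · by_cases h' : ∃ ℓ : ℕ, ℓ.Prime ∧ ℓ ∣ n' ∧ ((ℓ : ℕ) : 𝓞 K) ∈ v.asIdeal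
    · obtain ⟨ℓ, hℓ, hℓn', hℓv⟩ := h'
      exact hunr ℓ hℓ hℓn' (fun hℓn ↦ hno ⟨ℓ, hℓ, hℓn, hℓv⟩) v hpv hℓv 𝔓 h𝔓
    · exact hC v hpv h' 𝔓 h𝔓

omit [W.IsElliptic] [W.IsGloballyMinimal] in
/-- **Transfer UP along `n ∣ n'`**: a class of `Sel^ε_n` which is ORDINARY at every prime of `n'` not dividing `n` lies in `Sel^ε_{n'}`.
[cite: CastellaEtAl2025, §7.2 (arXiv:2308.10474v2 p0030 L16–L27)] [cite: Howard2006, §3.1, Prop. 2.2.9] -/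
theorem mem_signedOrdSelmerTorsion_of_dvd_of_forall_ordinaryAt {n n' m j : ℕ} (hdvd : n ∣ n')
    {c : (W.baseChange K).torsionH1Over ((p : ℤ) ^ j) (κ.layerSubgroup m)}
    (hc : c ∈ signedOrdSelmerTorsion (W.baseChange K) p κ ε n m j)
    (hord : ∀ ℓ : ℕ, ℓ.Prime → ℓ ∣ n' → ¬ ℓ ∣ n → ∀ v : HeightOneSpectrum (𝓞 K), ((p : ℕ) : 𝓞 K) ∉ v.asIdeal →
      ((ℓ : ℕ) : 𝓞 K) ∈ v.asIdeal → ∀ 𝔓 ∈ v.primesAbove, c ∈ ordinaryAt (W.baseChange K) ((p : ℤ) ^ j) (κ.layerSubgroup m) 𝔓) :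
    c ∈ signedOrdSelmerTorsion (W.baseChange K) p κ ε n' m j := by
  rw [mem_signedOrdSelmerTorsion_iff] at hc ⊢
  obtain ⟨hA, hB, hC⟩ := hc
  refine ⟨hA, fun v hpv hex 𝔓 h𝔓 ↦ ?_, fun v hpv hno' 𝔓 h𝔓 ↦ ?_⟩
  · obtain ⟨ℓ, hℓ, hℓn', hℓv⟩ := hex
    by_cases hℓn : ℓ ∣ n
    · exact hB v hpv ⟨ℓ, hℓ, hℓn, hℓv⟩ 𝔓 h𝔓
    · exact hord ℓ hℓ hℓn' hℓn v hpv hℓv 𝔓 h𝔓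
  · exact hC v hpv (fun ⟨ℓ, hℓ, hℓn, hℓv⟩ ↦ hno' ⟨ℓ, hℓ, hℓn.trans hdvd, hℓv⟩) 𝔓 h𝔓

omit [W.IsElliptic] in
/-- **`κ_j(m)_n ∈ Sel^ε_m(K_n, E[p^j])`** for `m ∈ 𝒩_j^ind` (the layer-`n` component of `kappa_mem`). [cite: CastellaEtAl2025, Thm. 7.4 (arXiv:2308.10474v2 p0030 L37–L43)] -/
theorem kappa_layer_mem_signedOrdSelmerTorsion (hB : IsSignedBipartiteSystem W K p κ γ N ε B) {j m : ℕ} (hj : 0 < j)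
    (hm : m ∈ indefProducts N K (fun ℓ ↦ W.frobeniusTrace ℓ) p j) (n : ℕ) :
    B.kappa j m n ∈ signedOrdSelmerTorsion (W.baseChange K) p κ ε m n j :=
  ((mem_signedOrdSelmer_iff _).mp (hB.kappa_mem j m hj hm)).1 n

omit [W.IsElliptic] [W.IsGloballyMinimal] in
/-- **A class NOT unramified at `𝔓` has non-zero restriction to `I_𝔓 ∩ Gal(K̄/K_∞)`** (bottom layer, `𝔓 ∣ v ∤ p`): `I_𝔓 ≤ ker κ` for every
`ℤ_p`-extension at `v ∤ p` (`ZpExtension.inertia_le_kerSubgroup_holds`, Washington Prop. 13.2), so the two restriction targets `H¹(Γ_{K_0} ∩ I_𝔓, ·)` and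
`H¹(I_𝔓 ∩ ker κ, ·)` see the same group; this is the ordinary coordinate `ordLoc_𝔓(·)_0(0)` of CHKLL25 (`ordLoc_apply_zero`).
[cite: Washington1997, Prop. 13.2] [cite: Howard2006, §2.2, Lem. 3.1.2] -/
theorem resOfLe_inertia_ne_zero_of_not_mem_unramifiedAt {v : HeightOneSpectrum (𝓞 K)} (hpv : ((p : ℕ) : 𝓞 K) ∉ v.asIdeal)
    {𝔓 : Ideal (absIntegers (𝓞 K) K)} (h𝔓 : 𝔓 ∈ v.primesAbove)
    {c : (W.baseChange K).torsionH1Over ((p : ℤ) ^ 1) (κ.layerSubgroup 0)}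
    (hc : c ∉ unramifiedAt (W.baseChange K) ((p : ℤ) ^ 1) (κ.layerSubgroup 0) 𝔓) :
    resOfLe (geomTorsion (W.baseChange K) ((p : ℤ) ^ 1))
      (inf_le_right.trans (κ.kerSubgroup_le_layerSubgroup 0) :
        𝔓.inertia (absoluteGaloisGroup K) ⊓ κ.kerSubgroup ≤ κ.layerSubgroup 0) c ≠ 0 := by
  have hIker : 𝔓.inertia (absoluteGaloisGroup K) ≤ κ.kerSubgroup :=
    ZpExtension.inertia_le_kerSubgroup_holds K p κ (by exact_mod_cast hpv) h𝔓
  intro h0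
  apply hc
  rw [mem_unramifiedAt_iff]
  obtain ⟨ψ, rfl⟩ := oneCocycleClass_surjective
    (discreteTopRep (κ.layerSubgroup 0) (geomTorsion (W.baseChange K) ((p : ℤ) ^ 1))) c
  obtain ⟨a, ha⟩ := (CocycleCriteria.resOfLe_oneCocycleClass_eq_zero_iff _ ψ).mp h0
  refine (CocycleCriteria.resOfLe_oneCocycleClass_eq_zero_iff _ ψ).mpr ⟨a, fun x ↦ ?_⟩
  have hxI : (x : absoluteGaloisGroup K) ∈ 𝔓.inertia (absoluteGaloisGroup K) := (Subgroup.mem_inf.mp x.2).2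
  let x' : ↥(𝔓.inertia (absoluteGaloisGroup K) ⊓ κ.kerSubgroup) := ⟨x, Subgroup.mem_inf.mpr ⟨hxI, hIker hxI⟩⟩
  have h1 := ha x'
  have h2 : Subgroup.inclusion (inf_le_right.trans (κ.kerSubgroup_le_layerSubgroup 0) :
      𝔓.inertia (absoluteGaloisGroup K) ⊓ κ.kerSubgroup ≤ κ.layerSubgroup 0) x' =
      Subgroup.inclusion (inf_le_left : κ.layerSubgroup 0 ⊓ 𝔓.inertia (absoluteGaloisGroup K) ≤ κ.layerSubgroup 0) x :=
    Subtype.ext rfl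
  rw [h2] at h1
  exact h1

/-- **`D_𝔓 ≤ ker κ` for EVERY prime `𝔓` of `K̄` over the place of an admissible prime** (`K` imaginary quadratic, `κ` anticyclotomic, `q`
Bertolini–Darmon admissible: inert and `≠ p`, so `(q)` splits completely in `K_∞/K`): the chosen prime `𝔓₀` has `D_{𝔓₀} = res(Γ_{K_v}) ≤ ker κ`
(`ZpExtension.decomp_le_kerSubgroup_of_span_natCast`), and `D_{g𝔓₀} = g D_{𝔓₀} g⁻¹` (`Γ_K` transitive on the primes over `v`).
[cite: Howard2006, Lem. 3.1.2 («𝔩 splits completely in D_∞»)] [cite: NeukirchANT1999, Ch. I §9 (9.1)] -/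
theorem decompositionSubgroup_le_kerSubgroup_of_isAdmissiblePrime (hK : IsImaginaryQuadratic K) (hκ : κ.IsAnticyclotomic) {q : ℕ}
    (hq : IsAdmissiblePrime (W.conductorNorm ℤ) K (fun ℓ ↦ W.frobeniusTrace ℓ) p 1 q)
    {v : HeightOneSpectrum (𝓞 K)} (hqv : ((q : ℕ) : 𝓞 K) ∈ v.asIdeal) {𝔓 : Ideal (absIntegers (𝓞 K) K)} (h𝔓 : 𝔓 ∈ v.primesAbove) :
    𝔓.decompositionSubgroup (absoluteGaloisGroup K) ≤ κ.kerSubgroup := by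
  have hq' := hq
  obtain ⟨hqprime, -, hinert, -, -⟩ := hq'
  obtain ⟨-, hpv⟩ := AdditiveKoly.hasGoodReductionAt_of_isAdmissiblePrime W K hq v hqv
  have hpv' : ((p : ℕ) : 𝓞 K) ∉ v.asIdeal := by rw [← Int.cast_natCast]; exact hpv
  have hbot : Ideal.span {((q : ℕ) : 𝓞 K)} ≠ ⊥ := by
    rw [Ne, Ideal.span_singleton_eq_bot]; exact_mod_cast hqprime.ne_zero
  have hspan : v.asIdeal = Ideal.span {((q : ℕ) : 𝓞 K)} :=
    ((hinert.isMaximal hbot).eq_of_le v.isPrime.ne_top ((Ideal.span_singleton_le_iff_mem _).mpr hqv)).symm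
  have hD0 : (adicCompletionPrime K v).decompositionSubgroup (absoluteGaloisGroup K) ≤ κ.kerSubgroup := by
    rw [decompositionSubgroup_adicCompletionPrime_eq_range]
    exact ZpExtension.decomp_le_kerSubgroup_of_span_natCast (κ := κ) hK hκ hpv' hspan
  obtain ⟨g, hg⟩ := HeightOneSpectrum.exists_smul_eq_of_mem_primesAbove_holds (adicCompletionPrime_mem_primesAbove K v) h𝔓
  intro x hx
  rw [← hg, Ideal.decompositionSubgroup_smul, Subgroup.mem_pointwise_smul_iff_inv_smul_mem] at hx
  have h1 : g⁻¹ * x * g ∈ κ.kerSubgroup := by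
    have h2 := hD0 hx
    rw [← map_inv, MulAut.smul_def, MulAut.conj_apply, inv_inv] at h2
    exact h2
  rw [ZpExtension.mem_kerSubgroup] at h1 ⊢
  have h3 : x = g * (g⁻¹ * x * g) * g⁻¹ := by group
  rw [h3, map_mul, map_mul, h1, mul_one, ← map_mul, mul_inv_cancel, map_one]

omit [NumberField K] [W.IsElliptic] [W.IsGloballyMinimal] [Fact p.Prime] in
/-- Bézout at `p` for an integer scalar: `p • u = 0`, `a • u = 0`, `p ∤ a` ⟹ `u = 0`. [folklore] -/
theorem eq_zero_of_zsmul_eq_zero_of_not_dvd {U : Type*} [AddCommGroup U] (hp : p.Prime) {u : U} (hpu : (p : ℤ) • u = 0) {a : ℤ}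
    (hau : a • u = 0) (ha : ¬ (p : ℤ) ∣ a) : u = 0 := by
  have hcop : IsCoprime (p : ℤ) a := (Irreducible.coprime_iff_not_dvd (Nat.prime_iff_prime_int.mp hp).irreducible).mpr ha
  obtain ⟨x, y, hxy⟩ := hcop
  calc u = (1 : ℤ) • u := (one_zsmul u).symm
    _ = (x * p + y * a) • u := by rw [hxy]
    _ = x • ((p : ℤ) • u) + y • (a • u) := by rw [add_zsmul, mul_zsmul, mul_zsmul]
    _ = 0 := by rw [hpu, hau, zsmul_zero, zsmul_zero, add_zero]

end Selmer


end Summit.BirchSwinnertonDyer.BirchSwinnertonDyer.Theorems.SignedBaseChangeAcDivAdmdefSelmerBookkeeping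

end
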